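import Mathlib
import Summits.NavierStokesRegularity.NavierStokesRegularity.Theorems.EulerZoomLiouvillePowerGaugeEulerLiouvilleBirthDefsFive
import Summits.NavierStokesRegularity.NavierStokesRegularity.Theorems.EulerZoomLiouvillePowerGaugeEulerLiouvilleSpiralEndgame
import Summits.NavierStokesRegularity.NavierStokesRegularity.Theorems.EulerZoomLiouvillePowerGaugeEulerLiouvilleSpiralLocData
import Summits.NavierStokesRegularity.NavierStokesRegularity.Theorems.EulerZoomLiouvillePowerGaugeEulerLiouvilleSelfSimilarLpProfile
import Summits.NavierStokesRegularity.NavierStokesRegularity.Theorems.EulerZoomLiouvillePowerGaugeEulerLiouvilleWeakConfinedVorticityIntrinsic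
import Summits.NavierStokesRegularity.NavierStokesRegularity.Theorems.EulerZoomLiouvillePowerGaugeEulerLiouvilleWeakIntegrableVorticity
import HarnessLib

/-!
# Crux `EulerZoomLiouville.PowerGaugeEulerLiouville` (stmt-NavierStokesRegularity-19832), line `relative_equilibria` (ns-idea-11):
# SPIRAL PARITY OF THE FOUR REGULARITY-FREE SUB-EXTREMAL SENSES (member, by name — the LEAD's binder `¬ IsPastSpiralTameWeak ρ u`)

Route `EulerZoomLiouville` (NavierStokesRegularity), crux E; seat ns-ezl-w3 g9, KEY W3-SPAR of LEAD ns-typeII-p2 g17 (2026-08-29 14:50Z).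
COMPOSITION ONLY.  The untwisted binder `IsPastSelfSimilarSubExtremal ρ u` (`…BirthDefsTwo`) has five senses; sense 1 (sub-extremal
profile energy) got its SPIRAL (O(3)-twisted, Perelman ansatz `u(τ,x) = (T−τ)^{γ−1} e^{(log(T−τ))S} V(e^{−(log(T−τ))S}(T−τ)^{−γ}(x−x₀))`,
`S` skew, `γ = 1/(2+ρ)`) parity in `Spiral.pastSpiralSubExtremal_trivial` (`…SpiralSubExtremalMember`, LEAD g17).  This file gives the
spiral parity of the four REGULARITY-FREE senses 2–5 (binder `Birth.IsPastSpiralTameWeak`, `…BirthDefsFive`), each with `ρ < ½`: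

* (2) an `L^q` tail of the profile off a ball, `2 ≤ q ≤ 3/(1+ρ)` — `Spiral.pastSpiral_trivial_of_memLp_exterior`;
* (3) a weak gradient a.e. symmetric off a ball (confined weak curl) — `Spiral.pastSpiral_trivial_of_confinedCurl`;
* (4) a weakly irrotational far field (test-function form) — `Spiral.pastSpiral_trivial_of_weaklyIrrotationalFar`;
* (5) an integrable, square-integrable weak curl — `Spiral.pastSpiral_trivial_of_integrableCurl`;
* ★ `Spiral.pastSpiralTameWeak_trivial` — the member: `InClass ρ u p H c → IsPastSpiralTameWeak ρ u → u = 0` a.e. on `(−∞,0) × ℝ³`.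

Mechanism (all by name): the spiral dictionary `Spiral.exists_locData_of_pastSpiral` (R3a; ns-ezl-w1 g10 et al.) supplies the
profile data (measurability, the weak gradient, the growth bound (A₁)); the profile is weakly divergence-free by the spiral profile
equation (`SpiralProfileEquation.spiral_profile_isWeaklyDivFree`, ns-ezl-w2 g8, fed by the pressure slaving
`Spiral.inClass_pastSpiralPressure`, ns-sfl-p1 g11, and the origin-centred extension `Spiral.isDistributional_spiralCollapse_of_pastSpiral`);
senses 3–5 are then PROFILE-LEVEL statements already in the tree for the untwisted case and blind to the twist
(`WeakConfinedVorticity.memLp_two_exterior_of_confinedCurl`, `.ae_symm_of_curlPair_eq_zero`, `.memLp_two_of_integrableCurl` give an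
`L²` tail), and an `L^q` tail gives sub-extremality (`LpProfile.subExtremal_of_memLp`), whence the radial Bronzi–Shvydkoy endgame
`Spiral.pastSpiral_trivial_of_locData_of_subExtremal` (LEAD g17).  `S = 0` is the untwisted binder (members
`LpProfile.selfSimilar_ae_eq_zero_of_memLp_profile_past`, `WeakConfinedVorticity.selfSimilar_ae_eq_zero_of_*_profile_past`).

PRIOR ART (rotated / discretely self-similar Euler non-existence under decay hypotheses): Chae, *J. Differential Equations* 2023,
doi:10.1016/j.jde.2023.08.037; Bronzi–Shvydkoy 2015 Thm 1.1 (energy non-concentration); Chae–Tsai 2013 (DSS).  Nothing here is new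
mathematics: it is the bookkeeping that the class budgets + a regularity-free far-field hypothesis exclude spiral collapse as they
exclude self-similar collapse.

WHAT THIS IS NOT: not NS, not E, not a reduction of the open stubs of the LEAD skeleton — one more SYMMETRY stratum of the OPEN crux
class (stmt-19832 stays OPEN); MODEL lattice only; `--supports` stmt-19832.
-/

noncomputable section

-- flat `Theorems/<Route><Decl>…` files of one crux share the namespace of the crux (tree convention: `Summit.<S>.<S>.…`)
set_option linter.dupNamespace false

open MeasureTheory Set Filter Topology Metric Function TopologicalSpace
open scoped ENNReal NNReal RealInnerProductSpace

namespace Summit.NavierStokesRegularity.NavierStokesRegularity.Theorems.PowerGaugeEulerLiouville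

open Literature.Analysis Literature.Analysis.FluidPDE Literature.Analysis.FunctionSpaces
open Summit.NavierStokesRegularity.NavierStokesRegularity.Theorems.PowerGaugeEulerLiouville.Birth

namespace Spiral

variable {ρ : ℝ} {u : ℝ → E3 → E3} {p : ℝ → E3 → ℝ} {H : ℝ → E3 → E3 →L[ℝ] E3} {c : ℝ≥0}
  {T T₁ : ℝ} {x₀ : E3} {S : E3 →L[ℝ] E3} {V : E3 → E3}

/-- **Profile basics of a spiral member** (read off the spiral dictionary and the spiral profile equation): for a member of the class
(`0 < ρ ≤ ½`) whose velocity is a Perelman spiral about `(T, x₀)` with skew generator `S` and profile `V` for `τ < T₁ ≤ min 0 T`, the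
profile is a.e. strongly measurable, locally square-integrable, obeys the growth bound (A₁) `∫_{B_L}|V|² ≤ c'·L^{1−2ρ}` (`L ≥ 1`) for
some constant `c'`, and is weakly divergence-free.  [`Spiral.exists_locData_of_pastSpiral`; `SpiralProfileEquation.spiral_profile_isWeaklyDivFree`] -/
theorem profile_basics_of_pastSpiral (hρ : 0 < ρ) (hρh : ρ ≤ 1 / 2) (h : InClass ρ u p H c)
    (hT₁ : T₁ ≤ 0) (hTT₁ : T₁ ≤ T) (hS : IsSkew S) (hu : IsPastSpiral ρ T T₁ x₀ S u V) :
    AEStronglyMeasurable V volume ∧ LocallyIntegrable (fun y => ‖V y‖ ^ 2) volume ∧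
      (∃ c' : ℝ≥0, ∀ L : ℝ, 1 ≤ L → ∫⁻ y in ball (0 : E3) L, ‖V y‖ₑ ^ 2 ≤ (c' : ℝ≥0∞) * ENNReal.ofReal (L ^ (1 - 2 * ρ))) ∧
      IsWeaklyDivFree V := by
  obtain ⟨P, G, c', hVm, -, -, hVG, hA₁, -⟩ := exists_locData_of_pastSpiral hρ hρh h hT₁ hTT₁ hS hu
  -- `V ∈ L²_loc` from (A₁)
  have hV2fin := Past.lintegral_ball_lt_top_of_growth ENNReal.coe_ne_top hA₁
  have hV2R := Past.memLp_two_ball_of_lintegral_lt_top hVm hV2fin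
  have hV2loc : LocallyIntegrable (fun y => ‖V y‖ ^ 2) volume := by
    refine (locallyIntegrable_iff).2 fun K hK => ?_
    obtain ⟨r, hr⟩ := hK.isBounded.subset_ball (0 : E3)
    have hi := (hV2R r).integrable_norm_pow two_ne_zero
    exact IntegrableOn.mono_set (show IntegrableOn (fun y => ‖V y‖ ^ 2) (ball 0 r) volume from hi) hr
  -- weak div-freeness: pressure slaving (P4) → origin-centred extension (P5) → spiral profile equation, div-free part (P6-IV)
  have hVloc : LocallyIntegrable V volume :=
    locallyIntegrableOn_univ.1 (by simpa only [Opens.coe_top] using hVG.locallyIntegrableOn)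
  obtain ⟨Q, p', -, hp', -, hcls'⟩ :=
    inClass_pastSpiralPressure (γ := 1 / (2 + ρ)) (by linarith : -1 / 2 < ρ) hT₁ hTT₁ hS h hu
  have hext := isDistributional_spiralCollapse_of_pastSpiral (γ := 1 / (2 + ρ)) hT₁ hTT₁ x₀ hS hcls'.1.distributional hu hp'
  have hdiv : IsWeaklyDivFree V :=
    SpiralProfileEquation.spiral_profile_isWeaklyDivFree hS hext (fun _ _ => rfl) hVloc
  exact ⟨hVm, hV2loc, ⟨c', hA₁⟩, hdiv⟩

/-- **Sense (2), spiral parity — an `L^q` tail off a ball excludes spiral collapse** (`0 < ρ < ½`, `2 ≤ q ≤ 3/(1+ρ)`,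
`V ∈ L^q({|y| ≥ R₀})`): the `L^q` tail makes the profile energy sub-extremal (`LpProfile.subExtremal_of_memLp`), and a sub-extremal
spiral member vanishes (`Spiral.pastSpiral_trivial_of_locData_of_subExtremal` ∘ `Spiral.exists_locData_of_pastSpiral`).  `S = 0`:
`LpProfile.selfSimilar_ae_eq_zero_of_memLp_profile_past`. [folklore; cf. BronziShvydkoy2015 Thm 1.1; ChaeTsai2013DSS] -/
theorem pastSpiral_trivial_of_memLp_exterior (hρ : 0 < ρ) (hρ2 : ρ < 1 / 2) (h : InClass ρ u p H c)
    (hT₁ : T₁ ≤ 0) (hTT₁ : T₁ ≤ T) (hS : IsSkew S) (hu : IsPastSpiral ρ T T₁ x₀ S u V)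
    {q R₀ : ℝ} (hq2 : 2 ≤ q) (hq : q ≤ 3 / (1 + ρ))
    (hVq : MemLp V (ENNReal.ofReal q) (volume.restrict {y : E3 | R₀ ≤ ‖y‖})) :
    Function.uncurry u =ᵐ[volume.restrict (Set.Iio (0 : ℝ) ×ˢ (Set.univ : Set E3))] 0 := by
  have hρh : ρ ≤ 1 / 2 := hρ2.le
  obtain ⟨hVm, hV2loc, -, -⟩ := profile_basics_of_pastSpiral hρ hρh h hT₁ hTT₁ hS hu
  obtain ⟨P, G, c', hloc⟩ := exists_locData_of_pastSpiral hρ hρh h hT₁ hTT₁ hS hu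
  exact pastSpiral_trivial_of_locData_of_subExtremal hρ hρh hTT₁ h.1 h.2.1 h.2.2 hS hu ⟨P, G, c', hloc⟩
    (LpProfile.subExtremal_of_memLp hρ hρ2 hq2 hq hVm hV2loc hVq)

/-- **Sense (3), spiral parity — a weak gradient a.e. symmetric off a ball (confined weak curl) excludes spiral collapse**
(`0 < ρ < ½`): the profile is weakly div-free (`profile_basics_of_pastSpiral`), so the confined weak curl gives an `L²` tail
(`WeakConfinedVorticity.memLp_two_exterior_of_confinedCurl`, with (A₁)), and sense (2) at `q = 2` applies.  `S = 0`:
`WeakConfinedVorticity.selfSimilar_ae_eq_zero_of_confinedCurl_profile_past`. [folklore; cf. BronziShvydkoy2015 Thm 1.1] -/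
theorem pastSpiral_trivial_of_confinedCurl (hρ : 0 < ρ) (hρ2 : ρ < 1 / 2) (h : InClass ρ u p H c)
    (hT₁ : T₁ ≤ 0) (hTT₁ : T₁ ≤ T) (hS : IsSkew S) (hu : IsPastSpiral ρ T T₁ x₀ S u V)
    {G : E3 → E3 →L[ℝ] E3} {R₀ : ℝ} (hVG : HasWeakFDerivOn (⊤ : Opens E3) volume V G)
    (hsymm : ∀ᵐ y ∂(volume : Measure E3), R₀ < ‖y‖ → ∀ v w : E3, ⟪G y v, w⟫ = ⟪G y w, v⟫) :
    Function.uncurry u =ᵐ[volume.restrict (Set.Iio (0 : ℝ) ×ˢ (Set.univ : Set E3))] 0 := by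
  obtain ⟨hVm, -, ⟨c', hA₁⟩, hdiv⟩ := profile_basics_of_pastSpiral hρ hρ2.le h hT₁ hTT₁ hS hu
  have hsymm' : ∀ᵐ y ∂(volume : Measure E3), max R₀ 0 < ‖y‖ → ∀ v w : E3, ⟪G y v, w⟫ = ⟪G y w, v⟫ := by
    filter_upwards [hsymm] with y hy hR
    exact hy (lt_of_le_of_lt (le_max_left _ _) hR)
  have hmem := WeakConfinedVorticity.memLp_two_exterior_of_confinedCurl hVG hdiv (le_max_right R₀ 0) hsymm' hVm
    ENNReal.coe_ne_top (θ := 1 - 2 * ρ) (L₀ := 1) (by linarith) hA₁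
  have hq : (2 : ℝ) ≤ 3 / (1 + ρ) := by
    rw [le_div_iff₀ (by linarith)]
    linarith
  have hmem' : MemLp V (ENNReal.ofReal 2) (volume.restrict {y : E3 | 2 * (max R₀ 0 + 1) ≤ ‖y‖}) := by
    rwa [ENNReal.ofReal_ofNat]
  exact pastSpiral_trivial_of_memLp_exterior hρ hρ2 h hT₁ hTT₁ hS hu le_rfl hq hmem'

/-- **Sense (4), spiral parity — a weakly irrotational far field (test-function form) excludes spiral collapse** (`0 < ρ < ½`):
the intrinsic curl-pair identities make the dictionary's weak gradient a.e. symmetric off the ball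
(`WeakConfinedVorticity.ae_symm_of_curlPair_eq_zero`), and sense (3) applies.  `S = 0`:
`WeakConfinedVorticity.selfSimilar_ae_eq_zero_of_weaklyIrrotationalFar_profile_past`. [folklore; cf. BronziShvydkoy2015 Thm 1.1] -/
theorem pastSpiral_trivial_of_weaklyIrrotationalFar (hρ : 0 < ρ) (hρ2 : ρ < 1 / 2) (h : InClass ρ u p H c)
    (hT₁ : T₁ ≤ 0) (hTT₁ : T₁ ≤ T) (hS : IsSkew S) (hu : IsPastSpiral ρ T T₁ x₀ S u V) {R₀ : ℝ}
    (hirr : ∀ g : E3 → ℝ, IsTestFunctionOn (⊤ : Opens E3) g → tsupport g ⊆ {y : E3 | R₀ < ‖y‖} →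
      ∀ a b : E3, ∫ x, ⟪V x, fderiv ℝ g x a • b - fderiv ℝ g x b • a⟫ = 0) :
    Function.uncurry u =ᵐ[volume.restrict (Set.Iio (0 : ℝ) ×ˢ (Set.univ : Set E3))] 0 := by
  obtain ⟨P, G, c', -, -, -, hVG, -⟩ := exists_locData_of_pastSpiral hρ hρ2.le h hT₁ hTT₁ hS hu
  exact pastSpiral_trivial_of_confinedCurl hρ hρ2 h hT₁ hTT₁ hS hu hVG
    (WeakConfinedVorticity.ae_symm_of_curlPair_eq_zero hVG hirr)

/-- **Sense (5), spiral parity — an integrable, square-integrable weak curl excludes spiral collapse** (`0 < ρ < ½`): with the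
profile weakly div-free and (A₁), `ω ∈ L¹ ∩ L²` (hence `∈ L^{6/5}`) puts the whole profile in `L²`
(`WeakConfinedVorticity.memLp_two_of_integrableCurl`), and sense (2) at `q = 2` applies.  `S = 0`:
`WeakConfinedVorticity.selfSimilar_ae_eq_zero_of_integrableCurl_profile_past`. [folklore; cf. BronziShvydkoy2015 Thm 1.1] -/
theorem pastSpiral_trivial_of_integrableCurl (hρ : 0 < ρ) (hρ2 : ρ < 1 / 2) (h : InClass ρ u p H c)
    (hT₁ : T₁ ≤ 0) (hTT₁ : T₁ ≤ T) (hS : IsSkew S) (hu : IsPastSpiral ρ T T₁ x₀ S u V)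
    {G : E3 → E3 →L[ℝ] E3} (hVG : HasWeakFDerivOn (⊤ : Opens E3) volume V G)
    (hω1 : Integrable (fun y => curlCLM (G y)) volume) (hω2 : MemLp (fun y => curlCLM (G y)) 2 volume) :
    Function.uncurry u =ᵐ[volume.restrict (Set.Iio (0 : ℝ) ×ˢ (Set.univ : Set E3))] 0 := by
  obtain ⟨hVm, -, ⟨c', hA₁⟩, hdiv⟩ := profile_basics_of_pastSpiral hρ hρ2.le h hT₁ hTT₁ hS hu
  have hω65 := WeakConfinedVorticity.lintegral_rpow_sixFifths_lt_top hω1 hω2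
  have hmem := WeakConfinedVorticity.memLp_two_of_integrableCurl hVG hdiv hVm hω1 hω65 ENNReal.coe_ne_top
    (θ := 1 - 2 * ρ) (L₀ := 1) (by linarith) (by linarith) hA₁
  have hq : (2 : ℝ) ≤ 3 / (1 + ρ) := by
    rw [le_div_iff₀ (by linarith)]
    linarith
  have hmem' : MemLp V (ENNReal.ofReal 2) (volume.restrict {y : E3 | (0 : ℝ) ≤ ‖y‖}) := by
    rw [ENNReal.ofReal_ofNat]
    exact hmem.restrict _
  exact pastSpiral_trivial_of_memLp_exterior hρ hρ2 h hT₁ hTT₁ hS hu le_rfl hq hmem'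

/-- ★ **THE TAME-WEAK SPIRAL STRATUM IS EMPTY IN THE CLASS** (line `relative_equilibria`, member level; the LEAD's binder
`¬ IsPastSpiralTameWeak ρ u` of skeleton v119, by name): crux hypotheses verbatim (`0 < ρ ≤ ½`, `InClass ρ u p H c`); a member whose
velocity is a Perelman spiral about some `(T, x₀)` with a skew generator on a past sub-slab and whose profile is tame-weak in one of
the four regularity-free senses (2)–(5) of `Birth.IsPastSpiralTameWeak` vanishes a.e. on `(−∞,0) × ℝ³`.  Case split into
`pastSpiral_trivial_of_memLp_exterior` / `_of_confinedCurl` / `_of_weaklyIrrotationalFar` / `_of_integrableCurl`.  Prior art for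
rotated self-similar Euler non-existence: Chae, J. Differential Equations 2023, doi:10.1016/j.jde.2023.08.037.
[folklore; cf. BronziShvydkoy2015 Thm 1.1; ChaeTsai2013DSS] -/
theorem pastSpiralTameWeak_trivial (hρ : 0 < ρ) (_hρh : ρ ≤ 1 / 2) (h : InClass ρ u p H c)
    (hS : IsPastSpiralTameWeak ρ u) :
    Function.uncurry u =ᵐ[volume.restrict (Set.Iio (0 : ℝ) ×ˢ (Set.univ : Set E3))] 0 := by
  rcases hS with ⟨T, T₁, x₀, S, V, q, R₀, hT₁, hTT₁, hSk, hsp, hρ2, hq2, hq, hVq⟩ |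
      ⟨T, T₁, x₀, S, V, G, R₀, hT₁, hTT₁, hSk, hsp, hρ2, hVG, hsymm⟩ | ⟨T, T₁, x₀, S, V, R₀, hT₁, hTT₁, hSk, hsp, hρ2, hirr⟩ |
      ⟨T, T₁, x₀, S, V, G, hT₁, hTT₁, hSk, hsp, hρ2, hVG, hω1, hω2⟩
  · exact pastSpiral_trivial_of_memLp_exterior hρ hρ2 h hT₁ hTT₁ hSk hsp hq2 hq hVq
  · exact pastSpiral_trivial_of_confinedCurl hρ hρ2 h hT₁ hTT₁ hSk hsp hVG hsymm
  · exact pastSpiral_trivial_of_weaklyIrrotationalFar hρ hρ2 h hT₁ hTT₁ hSk hsp hirr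
  · exact pastSpiral_trivial_of_integrableCurl hρ hρ2 h hT₁ hTT₁ hSk hsp hVG hω1 hω2

end Spiral

end Summit.NavierStokesRegularity.NavierStokesRegularity.Theorems.PowerGaugeEulerLiouville
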